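/-
Copyright (c) 2026 the pub-hodgecm-mathlib formalisation cell (harness21).  Prover seat hodgecm-mathlib-LH7-p01 (g8): N8-INNER ROAD B, E3a slice «hIT», THE COUPLING FACTOR ITSELF
(fork «(T1)+(T2)(T3)» accepted by the road owner LH2-plan (g1) 2026-09-02T17:38:14Z; E3a pen of record LH3-p04 (g8), §2 co-pen LH7-p04 (g9)).
-/
import Literature.NumberTheory.Rogawski1990.ArchEPAssemblyTransport          -- ★ (T1) p852310 (this seat): `blockReading_coupling_eq_average`; brings ★ (IT)-1∕2∕3, ★ (s1), ★ E2a, `archPiEquivCM`, `gprimeBlockAt`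
import Literature.NumberTheory.Rogawski1990.ArchEPAssemblyTestFunction       -- ★ §2(7) p852249 (this seat): the certificate shape; brings ★ `ArchSmooth.exists_contDiff`, ★ `snd_coe_coe_apply`
import Literature.Analysis.Calculus.GlaeserTorusLocalFintype                 -- ★ (B3) p852204 LH10-p02: `exists_contDiff_comp_classFun_near_of_mem_range` (local Glaeser on the torus with parameters)
import Literature.NumberTheory.Automorphic.ArchLocalTorusOrbitalBlockSmooth   -- ★ (A1) F0P3a: Hörmander `contDiffAt_integral_comp_of_contDiff_of_support`
import Literature.NumberTheory.Automorphic.ArchCompactPlaceOrbitalSmooth      -- ★ `compactSpace_archLocal_of_posDef`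
import Literature.NumberTheory.Rogawski1990.ArchInnerTwistChartDictionary      -- ★ `posDef_or_posDef_neg_diagonal_formRe_of_not_mem_splitChartPlaces`, `formSign_eq_of_not_mem_splitChartPlaces`
import Literature.NumberTheory.Automorphic.ArchInnerFormCartanAtlasSwap       -- ★ (SWAP-CONJ) LH4-p01: `exists_involutive_conj_gprimeTorus_swap` (realised Weyl reflections)
import Mathlib.Analysis.InnerProductSpace.EuclideanDist
import Mathlib.Analysis.Calculus.BumpFunction.FiniteDimension
import HarnessLib

/-!
# EP ASSEMBLY, the `hIT` slice II: THE COUPLING FACTOR of the per-ball test function — the `U(3)^D`-average of `a′` as a smooth function of (torus angles, ambient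
# `I`-block), its Weyl∕period invariance, the local Glaeser chart, the cut-off, and the `hIT` agreement (Rogawski 1990 §8.2, §14.2; Shelstad 1979 §4; Bouaziz 1994 §6.2)

Topic `NumberTheory/Rogawski1990`; namespace `Literature.NumberTheory.Rogawski1990`.  THEOREMS ONLY (no `def`, no instance, no notation, no axiom, no named fact, no `sorry`);
kernel lane `--kind proof --supports stmt-HodgeConjecture-24833`.  Cell `pub/hodgecm-mathlib`, crux H413 (`stmt-HodgeConjecture-24833`); HCML «GO 500» road N8-INNER ROAD B «EP road»
(owner∕dealer LH2-plan (g1)), brick (12′) «EP ASSEMBLY = H-S4′», file E3a (pen of record LH3-p04 (g8); HANDOFF-E3a `F0/P3c/LH7/LH7-p04/g8/e3a/HANDOFF-E3a.LH7p04g8.md` §3 (4); hIT census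
`F0/P3c/LH7/LH7-p01/g8/hit/CENSUS-hIT.v1.LH7p01g8.md` §2).  Count-neutral; HONEST LABEL: HC_CM is proved only modulo the 7 printed citations (2 remaining: hLiu418 = stmt-HodgeConjecture-24832,
h413 = stmt-HodgeConjecture-24833) until rung 0 closes.

THE OBJECT.  `G′_∞ = U(diag α)(L⁺ ⊗ ℝ) ≃ Π_w U(α)_w` (★ `archPiEquivCM`), `p` the block of `α`-DEFINITE places (`p w → w ∉ splitChartPlaces L α`: `U(α)_w` is compact there), `¬p` the indefinite
block carrying the place isomorphisms `ι_{w′} : U(α)_{w′} ≃ U(β)_{w′}`, `↑(ι h) = M_{w′} ↑h M_{w′}⁻¹` (★ (IT)-1).  For `a′ ∈ C_c^∞(G′_∞)` (ambient lift `Θ`, ★ `ArchSmooth.exists_contDiff`) the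
**AMBIENT `U(3)^D`-AVERAGE** is `Ā(x, Z) := ∫_{Π_p U(α)_w} Θ (asm ((↑g_w · diag(e^{i x_w ∘ τ_w⁻¹}) · ↑g_w⁻¹)_{p}, (M_{w′}⁻¹ Z_{w′} M_{w′})_{¬p})) d⊗_p ν′_w`, `x : {w // p w} → Fin 3 → ℝ` torus angles,
`Z : {w // ¬ p w} → M₃(ℂ)` an AMBIENT `β`-side `I`-block, `asm` the linear assembling map `(M₃(ℂ))^W → M₃(L ⊗ ℝ)` (no real places: ★ `isEmpty_isReal`).  At group points `Z = ↑(ι_I y)` it IS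
the group average `∫ a′ (e_α⁻¹ ((g γ^α_w(x_w) g⁻¹)_p, y)) d⊗ν′` of ★ (s1) ∕ ★ (T1)'s `hG`.
* §1 `exists_assembleCLM` — the assembling CLM and `asm (blocks k) = ↑↑k`.
* §2 chart bookkeeping at a definite place (label independence, realised slot transpositions, the `C^∞` periodic chart matrix); §3 `exists_ambientAverage` — `Ā` EXISTS with: `ContDiff ℝ ∞` jointly (★ (A1) Hörmander over the COMPACT `Π_p U(α)_w`, `S := univ`), `S₃`-symmetry in each `x_w` (★ realised Weyl reflections
  `exists_involutive_conj_gprimeTorus_swap` at a definite place — all three signs agree, ★ `formSign_eq_of_not_mem_splitChartPlaces` — and right-invariance of `⊗ν′_w`), `2πℤ³`-periodicity,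
  and the group-point reading above.
* §4 **`exists_coupling`** — (B3) ★ `exists_contDiff_comp_classFun_near_of_mem_range` at a centre `b ∈ K^D` gives `ε > 0` and a smooth `Ã` with `Ā(x, Z) = Ã(cl x, Z)` on the `ε`-ball;
  a cut-off `χ` (Mathlib `ContDiffBump` through `toEuclidean`) equal to `1` on the compact `ι_I(pr_I(e_α(tsupport a′)))`; `G z y_β := χ(↑y_β) · Ã(z, ↑y_β)`.  CONCLUSIONS: (a) the §2(7)
  certificate (smooth ambient `Gamb = χ · Ã` vanishing off the compact `tsupport χ` in the `I`-variable — docks on ★ `archSmooth_prod_classMul_tensor_mul_coupling_of_forall_eq_zero`);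
  (b) the (T1) hypothesis `hG` on the `ε`-ball: `G (cl x) (ι_I y) = ∫ a′ (e_α⁻¹ ((g γ^α(x) g⁻¹)_p, y)) d⊗ν′` (label-free `S := ∅` at the definite places; ★ label independence
  `coe_gprimeBlock_of_not_mem_splitChartPlaces` for any other label).
* §5 `blockReading_eq_of_coupling_near` — ★ CORE's `hIT` body from (b) and ★ (T1), two-frame statement in (T1)'s hygiene (the `β`-frame measure facts as an `And`-package).

## References
* [Rogawski1990] J. D. Rogawski, *Automorphic Representations of Unitary Groups in Three Variables*, Ann. of Math. Stud. 123 (1990), §8.2 p. 122 (orbital integrals place by place), §14.2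
  (14.2.1) pp. 232–233 (the inner transfer of `C_c^∞` functions), §4.3 p. 43.
* [Shelstad1979] D. Shelstad, *Characters and inner forms of a quasi-split group over ℝ*, Compositio Math. 39 (1979), §4 pp. 22–26 (transfer assembled place by place on the Cartan).
* [Bouaziz1994IntegralesOrbitales] A. Bouaziz, *Intégrales orbitales sur les groupes de Lie réductifs*, Ann. Sci. ÉNS (4) 27 (1994), §6.2 pp. 591–594 (class-space localisation, invariant germs).
* [HormanderALPDO1] L. Hörmander, *The Analysis of Linear Partial Differential Operators I* (1990), Thm. 1.1.9 (differentiation under the integral sign).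
* [Glaeser1963Newton] G. Glaeser, *Fonctions composées différentiables*, Ann. of Math. 77 (1963), Thm. II.
-/

set_option autoImplicit false

noncomputable section

open MeasureTheory MeasureTheory.Measure NumberField NumberField.InfinitePlace NumberField.mixedEmbedding Matrix Complex Topology Function Set Filter
open Literature.MeasureTheory.Group Literature.NumberTheory.Automorphic Literature.NumberTheory.Automorphic.UnitaryGroup Literature.NumberTheory.Automorphic.ArchCartan
open Literature.Analysis.Calculus
open scoped MatrixGroups Matrix Classical ENNReal NNReal ContDiff

namespace Literature.NumberTheory.Rogawski1990

-- the scoped `ℓ^∞`-operator norm on `M₃(L ⊗ ℝ)` and `M₃(ℂ)` (the one through which ★ `IsArchSmooth`, ★ E1's ambient `fa` and ★ (B3)'s parameter space are read)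
open scoped Matrix.Norms.Operator

/-! ## §1 The assembling map `(M₃(ℂ))^{p ⊔ ¬p} → M₃(L ⊗ ℝ)` -/

section Assemble

variable (L : Type) [Field L] [NumberField L] [IsCMField L] (α : Fin 3 → L) (p : {w : InfinitePlace L // IsComplex w} → Prop) [DecidablePred p]

set_option backward.isDefEq.respectTransparency false in
/-- **THE ASSEMBLING MAP**: a continuous `ℝ`-linear `asm : (M₃(ℂ))^{p} × (M₃(ℂ))^{¬p} → M₃(L ⊗ ℝ)` (complex coordinates block by block; no real places for a CM field, ★ `isEmpty_isReal`) with
`asm ((↑k_w)_{p}, (↑k_{w′})_{¬p}) = ↑k` for every `k ∈ G′_∞` (★ `snd_coe_coe_apply`). [cite: Rogawski1990, §4.3 p. 43] [cite: BorelJacquet1979, §4.1] -/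
theorem exists_assembleCLM :
    ∃ asm : (({w : {w : InfinitePlace L // IsComplex w} // p w} → Matrix (Fin 3) (Fin 3) ℂ) × ({w : {w : InfinitePlace L // IsComplex w} // ¬ p w} → Matrix (Fin 3) (Fin 3) ℂ)) →L[ℝ]
        Matrix (Fin 3) (Fin 3) (mixedSpace L),
      (∀ U, ∀ (i j : Fin 3) (w : {w : InfinitePlace L // IsComplex w}),
          (asm U i j).2 w = if h : p w then U.1 ⟨w, h⟩ i j else U.2 ⟨w, h⟩ i j) ∧
      ∀ k : ↥(arch (↥(maximalRealSubfield L)) L (IsCMField.complexConj L) 3 (Matrix.diagonal α)),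
        asm (fun w => ((archPiEquivCM 3 L (Matrix.diagonal α) k w.1 : GL (Fin 3) ℂ) : Matrix (Fin 3) (Fin 3) ℂ),
              fun w' => ((archPiEquivCM 3 L (Matrix.diagonal α) k w'.1 : GL (Fin 3) ℂ) : Matrix (Fin 3) (Fin 3) ℂ)) =
          ((k : GL (Fin 3) (mixedSpace L)) : Matrix (Fin 3) (Fin 3) (mixedSpace L)) := by
  haveI : FiniteDimensional ℝ (Matrix (Fin 3) (Fin 3) (mixedSpace L)) := finiteDimensional_matrix_mixedSpace
  haveI : IsEmpty {w : InfinitePlace L // IsReal w} := isEmpty_isReal (↥(maximalRealSubfield L)) L (IsCMField.complexConj L) (IsCMField.complexConj_ne_one L) (complexConj_smul_infinitePlace L)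
  -- the raw linear map
  let f : (({w : {w : InfinitePlace L // IsComplex w} // p w} → Matrix (Fin 3) (Fin 3) ℂ) × ({w : {w : InfinitePlace L // IsComplex w} // ¬ p w} → Matrix (Fin 3) (Fin 3) ℂ)) →ₗ[ℝ]
      Matrix (Fin 3) (Fin 3) (mixedSpace L) :=
    { toFun := fun U => Matrix.of fun i j => ((fun _ => 0 : {w : InfinitePlace L // IsReal w} → ℝ), fun w => if h : p w then U.1 ⟨w, h⟩ i j else U.2 ⟨w, h⟩ i j)
      map_add' := fun U V => by
        ext i j
        · exact (zero_add _).symm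
        · rename_i w
          simp only [Matrix.of_apply, Matrix.add_apply, Prod.fst_add, Prod.snd_add, Pi.add_apply]
          split_ifs <;> rfl
      map_smul' := fun r U => by
        ext i j
        · simp
        · rename_i w
          simp only [Matrix.of_apply, Matrix.smul_apply, Prod.smul_fst, Prod.smul_snd, Pi.smul_apply, RingHom.id_apply]
          split_ifs <;> rfl }
  refine ⟨LinearMap.toContinuousLinearMap f, fun U i j w => rfl, fun k => ?_⟩
  refine Matrix.ext fun i j => Prod.ext (funext fun v => isEmptyElim v) (funext fun w => ?_)
  show (if h : p w then _ else _) = _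
  rw [snd_coe_coe_apply L α k w i j]
  split_ifs <;> rfl

end Assemble

/-! ## §2 Local chart bookkeeping at a definite place -/

section Chart

variable (L : Type) [Field L] [NumberField L] [IsCMField L] (α : Fin 3 → L)

omit [NumberField L] [IsCMField L] in
/-- The matrix of the local compact chart `gprimeBlockAt L α w ∅ cw`: `diag(e^{i cw (τ⁻¹ ℓ)})`, `τ = lineOf (formSign L α w)` (★ `coe_gprimeBlock_of_not_mem`, ★ `coe_gprimeCptGL`).
[cite: Rogawski1990, §3.6 p. 31] -/
theorem coe_coe_gprimeBlockAt_empty (w : {w : InfinitePlace L // IsComplex w}) (cw : Fin 3 → ℝ) :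
    (((gprimeBlockAt L α w ∅ cw : ↥(archLocal L 3 (Matrix.diagonal α) w)) : GL (Fin 3) ℂ) : Matrix (Fin 3) (Fin 3) ℂ) =
      Matrix.diagonal fun ℓ => Complex.exp ((cw ((lineOf (formSign L α w)).symm ℓ) : ℂ) * I) := by
  rw [show gprimeBlockAt L α w ∅ cw = gprimeBlock L α w ∅ (fun _ => cw) from rfl, coe_gprimeBlock_of_not_mem L α _ (Finset.notMem_empty w), coe_gprimeCptGL]

omit [NumberField L] [IsCMField L] in
/-- At a DEFINITE place (`w ∉ splitChartPlaces L α`, house frame) the local chart does not depend on the label. [cite: Rogawski1990, §3.6 p. 31] -/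
theorem gprimeBlockAt_eq_empty_of_not_mem_splitChartPlaces {w : {w : InfinitePlace L // IsComplex w}} (hw : w ∉ splitChartPlaces L α) (S' : Finset {w : InfinitePlace L // IsComplex w}) (cw : Fin 3 → ℝ) :
    gprimeBlockAt L α w S' cw = gprimeBlockAt L α w ∅ cw := by
  apply Subtype.ext
  rw [show gprimeBlockAt L α w S' cw = gprimeBlock L α w S' (fun _ => cw) from rfl, show gprimeBlockAt L α w ∅ cw = gprimeBlock L α w ∅ (fun _ => cw) from rfl,
    coe_gprimeBlock_of_not_mem_splitChartPlaces L α _ hw, coe_gprimeBlock_of_not_mem_splitChartPlaces L α _ hw]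

omit [NumberField L] [IsCMField L] in
/-- The chart matrix `cw ↦ diag(e^{i cw (τ⁻¹ ℓ)})` is `C^∞` in the angles. [cite: Rogawski1990, §8.4 p. 126] -/
theorem contDiff_chartDiagonal (τ : Equiv.Perm (Fin 3)) :
    ContDiff ℝ ∞ fun cw : Fin 3 → ℝ => (Matrix.diagonal fun ℓ => Complex.exp ((cw (τ.symm ℓ) : ℂ) * I) : Matrix (Fin 3) (Fin 3) ℂ) := by
  let D : (Fin 3 → ℂ) →L[ℝ] Matrix (Fin 3) (Fin 3) ℂ := LinearMap.toContinuousLinearMap (Matrix.diagonalLinearMap (Fin 3) ℝ ℂ)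
  have hD : ∀ d : Fin 3 → ℂ, D d = Matrix.diagonal d := fun _ => rfl
  have hfun : (fun cw : Fin 3 → ℝ => (Matrix.diagonal fun ℓ => Complex.exp ((cw (τ.symm ℓ) : ℂ) * I) : Matrix (Fin 3) (Fin 3) ℂ)) =
      fun cw => D fun ℓ => Complex.exp ((cw (τ.symm ℓ) : ℂ) * I) := by
    funext cw; rw [hD]
  rw [hfun]
  exact D.contDiff.comp (contDiff_pi.2 fun ℓ => Complex.contDiff_exp.comp ((Complex.ofRealCLM.contDiff.comp (contDiff_apply ℝ ℝ (τ.symm ℓ))).mul contDiff_const))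

omit [NumberField L] [IsCMField L] in
/-- The chart matrix is `2πℤ³`-periodic in the angles. [cite: Rogawski1990, §3.6 p. 31] -/
theorem chartDiagonal_add_two_pi_mul (τ : Equiv.Perm (Fin 3)) (cw : Fin 3 → ℝ) (n : Fin 3 → ℤ) :
    (Matrix.diagonal fun ℓ => Complex.exp ((((cw + fun k => 2 * Real.pi * (n k : ℝ)) (τ.symm ℓ) : ℝ) : ℂ) * I) : Matrix (Fin 3) (Fin 3) ℂ) =
      Matrix.diagonal fun ℓ => Complex.exp ((cw (τ.symm ℓ) : ℂ) * I) := by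
  congr 1
  funext ℓ
  rw [Pi.add_apply, Complex.ofReal_add, add_mul, Complex.exp_add]
  have h : Complex.exp (((2 * Real.pi * (n (τ.symm ℓ) : ℝ) : ℝ) : ℂ) * I) = 1 := by
    have h2 : (((2 * Real.pi * (n (τ.symm ℓ) : ℝ) : ℝ) : ℂ) * I) = (n (τ.symm ℓ) : ℂ) * (2 * Real.pi * I) := by push_cast; ring
    rw [h2]
    exact Complex.exp_int_mul_two_pi_mul_I _
  rw [h, mul_one]

/-- **At a DEFINITE place every transposition of the chart slots is realised by conjugation in `U(α)_w`** (all three signs agree off the split-chart places ★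
`formSign_eq_of_not_mem_splitChartPlaces`; ★ (SWAP-CONJ) `exists_involutive_conj_gprimeTorus_swap` read at the place `w` through ★ `archPiEquivCM`). [cite: Shelstad1979, §4 p. 23]
[cite: Rogawski1990, §3.6 p. 31] -/
theorem exists_conj_gprimeBlockAt_empty_eq_comp_swap (hα : ∀ i, α i ≠ 0) {w : {w : InfinitePlace L // IsComplex w}} (hreal : ∀ i, (w.1.embedding (α i)).im = 0) (hw : w ∉ splitChartPlaces L α) (i j : Fin 3) :
    ∃ n : ↥(archLocal L 3 (Matrix.diagonal α) w), ∀ cw : Fin 3 → ℝ, n * gprimeBlockAt L α w ∅ cw * n⁻¹ = gprimeBlockAt L α w ∅ (cw ∘ ⇑(Equiv.swap i j)) := by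
  obtain ⟨h01, h12⟩ := formSign_eq_of_not_mem_splitChartPlaces L hα hreal hw
  have hall : ∀ a b : Fin 3, formSign L α w a = formSign L α w b := by
    have h0 : ∀ a : Fin 3, formSign L α w a = formSign L α w 0 := by
      intro a; fin_cases a
      · rfl
      · exact h01.symm
      · exact (h01.trans h12).symm
    intro a b; rw [h0 a, h0 b]
  obtain ⟨g, -, hg⟩ := exists_involutive_conj_gprimeTorus_swap L α hα hreal (S' := (∅ : Finset {w : InfinitePlace L // IsComplex w})) (Finset.notMem_empty w) i j (hall _ _)
  refine ⟨archPiEquivCM 3 L (Matrix.diagonal α) g w, fun cw => ?_⟩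
  have h := congrArg (fun k => archPiEquivCM 3 L (Matrix.diagonal α) k w) (hg (fun _ => cw))
  simp only [map_mul, map_inv, Pi.mul_apply, Pi.inv_apply, archPiEquivCM_gprimeTorus, gprimeBlock_eq_gprimeBlockAt, Function.update_self] at h
  exact h

end Chart

/-! ## §3 The ambient `U(3)^D`-average: smoothness, Weyl and period invariance, group-point reading -/

section Average

variable (L : Type) [Field L] [NumberField L] [IsCMField L] (α : Fin 3 → L) (p : {w : InfinitePlace L // IsComplex w} → Prop) [DecidablePred p]
  [Fintype {w : {w : InfinitePlace L // IsComplex w} // p w}] [Fintype {w : {w : InfinitePlace L // IsComplex w} // ¬ p w}]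
  [∀ w : {w : InfinitePlace L // IsComplex w}, MeasurableSpace ↥(archLocal L 3 (Matrix.diagonal α) w)]
  [∀ w : {w : InfinitePlace L // IsComplex w}, BorelSpace ↥(archLocal L 3 (Matrix.diagonal α) w)]
  [∀ w : {w : InfinitePlace L // IsComplex w}, SecondCountableTopology ↥(archLocal L 3 (Matrix.diagonal α) w)]
  (ν'w : ∀ w : {w : InfinitePlace L // IsComplex w}, Measure ↥(archLocal L 3 (Matrix.diagonal α) w)) [∀ w, (ν'w w).IsHaarMeasure] [∀ w, (ν'w w).IsMulRightInvariant]

/-- **THE AMBIENT `U(3)^D`-AVERAGE OF `a′ ∈ C_c^∞(G′_∞)`**, over the block `p` of DEFINITE places (`U(α)_w` compact there), conjugated on the `¬p`-block by the fixed matrices `M_{w′}`: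
there is `Ā : (Π_p ℝ³) × (Π_{¬p} M₃(ℂ)) → ℂ` with
(i) `ContDiff ℝ ∞ Ā` — the integrand `Θ (asm ((↑g_w · diag(e^{ix_w∘τ⁻¹}) · ↑g_w⁻¹)_p, (M⁻¹ Z M)_{¬p}))` is jointly smooth in (parameter `(↑g, ↑g⁻¹)`, variable `(x, Z)`) and the parameter space `Π_p U(α)_w` is COMPACT, so
★ (A1) Hörmander `contDiffAt_integral_comp_of_contDiff_of_support` applies with `S := univ`;
(ii) `S₃`-symmetry in each `x_w` — a transposition of the slots is conjugation by some `n ∈ U(α)_w` (`exists_conj_gprimeBlockAt_empty_eq_comp_swap`), absorbed by `g_w ↦ g_w n` (right invariance of `⊗_p ν′_w`);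
(iii) `2πℤ³`-periodicity in each `x_w`; (iv) the GROUP-POINT READING: at `Z = (M_{w′} ↑y_{w′} M_{w′}⁻¹)_{w′}` (`y` an `α`-side `¬p`-block) `Ā (x, Z) = ∫ a′ (e_α⁻¹ ((g_w γ^α_w(x_w) g_w⁻¹)_p, y)) d⊗_p ν′_w`
(label `∅` at the definite places).  This is the function fed to ★ (B3) (local Glaeser on the torus with parameters). [cite: Rogawski1990, §8.2 p. 122; §14.2 p. 233] [cite: Shelstad1979, §4 p. 24]
[cite: HormanderALPDO1, Thm. 1.1.9] [cite: Bouaziz1994IntegralesOrbitales, §6.2 p. 591] -/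
theorem exists_ambientAverage (hα : ∀ i, α i ≠ 0) (hreal : ∀ (w : {w : InfinitePlace L // IsComplex w}) (i : Fin 3), (w.1.embedding (α i)).im = 0) (hp : ∀ w, p w → w ∉ splitChartPlaces L α)
    (a' : ↥(arch (↥(maximalRealSubfield L)) L (IsCMField.complexConj L) 3 (Matrix.diagonal α)) → ℂ) (ha' : ArchSmooth L 3 (Matrix.diagonal α) a')
    (M : {w : {w : InfinitePlace L // IsComplex w} // ¬ p w} → GL (Fin 3) ℂ) :
    ∃ A : ({w : {w : InfinitePlace L // IsComplex w} // p w} → Fin 3 → ℝ) × ({w : {w : InfinitePlace L // IsComplex w} // ¬ p w} → Matrix (Fin 3) (Fin 3) ℂ) → ℂ,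
      ContDiff ℝ ∞ A ∧
      (∀ (w : {w : {w : InfinitePlace L // IsComplex w} // p w}) (σ : Equiv.Perm (Fin 3)) (x : {w : {w : InfinitePlace L // IsComplex w} // p w} → Fin 3 → ℝ) (Z : {w : {w : InfinitePlace L // IsComplex w} // ¬ p w} → Matrix (Fin 3) (Fin 3) ℂ),
        A (Function.update x w (x w ∘ ⇑σ), Z) = A (x, Z)) ∧
      (∀ (w : {w : {w : InfinitePlace L // IsComplex w} // p w}) (n : Fin 3 → ℤ) (x : {w : {w : InfinitePlace L // IsComplex w} // p w} → Fin 3 → ℝ) (Z : {w : {w : InfinitePlace L // IsComplex w} // ¬ p w} → Matrix (Fin 3) (Fin 3) ℂ),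
        A (Function.update x w (x w + fun k => 2 * Real.pi * (n k : ℝ)), Z) = A (x, Z)) ∧
      ∀ (x : {w : {w : InfinitePlace L // IsComplex w} // p w} → Fin 3 → ℝ) (y : ∀ w' : {w : {w : InfinitePlace L // IsComplex w} // ¬ p w}, ↥(archLocal L 3 (Matrix.diagonal α) w'.1)),
        A (x, fun w' => ((M w' : GL (Fin 3) ℂ) : Matrix (Fin 3) (Fin 3) ℂ) * ((y w' : GL (Fin 3) ℂ) : Matrix (Fin 3) (Fin 3) ℂ) * (((M w')⁻¹ : GL (Fin 3) ℂ) : Matrix (Fin 3) (Fin 3) ℂ)) =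
          ∫ g : (∀ w : {w : {w : InfinitePlace L // IsComplex w} // p w}, ↥(archLocal L 3 (Matrix.diagonal α) w.1)),
            a' ((archPiEquivCM 3 L (Matrix.diagonal α)).symm
              ((MeasurableEquiv.piEquivPiSubtypeProd (fun w : {w : InfinitePlace L // IsComplex w} => ↥(archLocal L 3 (Matrix.diagonal α) w)) p).symm
                (fun w => g w * gprimeBlockAt L α w.1 ∅ (x w) * (g w)⁻¹, y)))
            ∂(Measure.pi fun w : {w : {w : InfinitePlace L // IsComplex w} // p w} => ν'w w.1) := by
  haveI : FiniteDimensional ℝ (Matrix (Fin 3) (Fin 3) (mixedSpace L)) := finiteDimensional_matrix_mixedSpace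
  -- the definite places are compact
  haveI : ∀ w : {w : {w : InfinitePlace L // IsComplex w} // p w}, CompactSpace ↥(archLocal L 3 (Matrix.diagonal α) w.1) := fun w => by
    refine compactSpace_archLocal_of_posDef L 3 α w.1 ?_
    rw [diagonal_map_embedding_eq_of_real (hreal w.1)]
    exact posDef_or_posDef_neg_diagonal_formRe_of_not_mem_splitChartPlaces L hα (hreal w.1) (hp w.1 w.2)
  -- the ambient lift of `a′` and the assembling map
  obtain ⟨Θ, hΘ, -, -, hΘa⟩ := ha'.exists_contDiff
  obtain ⟨asm, hasm, hasmk⟩ := exists_assembleCLM L α p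
  -- the jointly smooth integrand `Ψ ((A_g, B_g), (x, Z))` and the continuous parameter map `y_g = (↑g, ↑g⁻¹)`
  set Ψ : (({w : {w : InfinitePlace L // IsComplex w} // p w} → Matrix (Fin 3) (Fin 3) ℂ) × ({w : {w : InfinitePlace L // IsComplex w} // p w} → Matrix (Fin 3) (Fin 3) ℂ)) ×
      (({w : {w : InfinitePlace L // IsComplex w} // p w} → Fin 3 → ℝ) × ({w : {w : InfinitePlace L // IsComplex w} // ¬ p w} → Matrix (Fin 3) (Fin 3) ℂ)) → ℂ :=
    fun q => Θ (asm (fun w => q.1.1 w * (Matrix.diagonal fun ℓ => Complex.exp ((q.2.1 w ((lineOf (formSign L α w.1)).symm ℓ) : ℂ) * I)) * q.1.2 w,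
      fun w' => (((M w')⁻¹ : GL (Fin 3) ℂ) : Matrix (Fin 3) (Fin 3) ℂ) * q.2.2 w' * ((M w' : GL (Fin 3) ℂ) : Matrix (Fin 3) (Fin 3) ℂ))) with hΨ
  have hΨd : ContDiff ℝ ∞ Ψ := by
    refine hΘ.comp (asm.contDiff.comp (ContDiff.prodMk (contDiff_pi.2 fun w => ?_) (contDiff_pi.2 fun w' => ?_)))
    · exact (((contDiff_apply ℝ _ w).comp (contDiff_fst.comp contDiff_fst)).mul
        ((contDiff_chartDiagonal (lineOf (formSign L α w.1))).comp ((contDiff_apply ℝ _ w).comp (contDiff_fst.comp contDiff_snd)))).mul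
        ((contDiff_apply ℝ _ w).comp (contDiff_snd.comp contDiff_fst))
    · exact (contDiff_const.mul ((contDiff_apply ℝ _ w').comp (contDiff_snd.comp contDiff_snd))).mul contDiff_const
  set yp : (∀ w : {w : {w : InfinitePlace L // IsComplex w} // p w}, ↥(archLocal L 3 (Matrix.diagonal α) w.1)) →
      ({w : {w : InfinitePlace L // IsComplex w} // p w} → Matrix (Fin 3) (Fin 3) ℂ) × ({w : {w : InfinitePlace L // IsComplex w} // p w} → Matrix (Fin 3) (Fin 3) ℂ) :=
    fun g => (fun w => ((g w : GL (Fin 3) ℂ) : Matrix (Fin 3) (Fin 3) ℂ), fun w => ((((g w)⁻¹ : ↥(archLocal L 3 (Matrix.diagonal α) w.1)) : GL (Fin 3) ℂ) : Matrix (Fin 3) (Fin 3) ℂ)) with hyp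
  have hypc : Continuous yp := by
    refine (continuous_pi fun w => ?_).prodMk (continuous_pi fun w => ?_)
    · exact Units.continuous_val.comp (continuous_subtype_val.comp (continuous_apply w))
    · exact Units.continuous_val.comp (continuous_subtype_val.comp ((continuous_apply w).inv))
  refine ⟨fun X => ∫ g, Ψ (yp g, X) ∂(Measure.pi fun w : {w : {w : InfinitePlace L // IsComplex w} // p w} => ν'w w.1), ?_, ?_, ?_, ?_⟩
  · -- (i) smoothness: Hörmander with `S := univ` (compact parameter space)
    refine contDiff_iff_contDiffAt.2 fun X₀ => ?_
    exact contDiffAt_integral_comp_of_contDiff_of_support (Measure.pi fun w : {w : {w : InfinitePlace L // IsComplex w} // p w} => ν'w w.1) Ψ hΨd yp hypc X₀ isCompact_univ Filter.univ_mem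
      (fun t ht _ _ => (ht (Set.mem_univ t)).elim)
  · -- (ii) `S₃`-symmetry, by induction over transpositions
    intro w₀ σ
    induction σ using Equiv.Perm.swap_induction_on with
    | one => intro x Z; rw [Equiv.Perm.coe_one, Function.comp_id, Function.update_eq_self]
    | swap_mul f i j hij ih =>
      intro x Z
      -- realise the transposition at the place `w₀`
      obtain ⟨n, hn⟩ := exists_conj_gprimeBlockAt_empty_eq_comp_swap L α hα (hreal w₀.1) (hp w₀.1 w₀.2) i j
      have hnm : ∀ cw : Fin 3 → ℝ, ((n : GL (Fin 3) ℂ) : Matrix (Fin 3) (Fin 3) ℂ) * (Matrix.diagonal fun ℓ => Complex.exp ((cw ((lineOf (formSign L α w₀.1)).symm ℓ) : ℂ) * I)) *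
          ((((n⁻¹ : ↥(archLocal L 3 (Matrix.diagonal α) w₀.1)) : GL (Fin 3) ℂ) : Matrix (Fin 3) (Fin 3) ℂ)) =
            Matrix.diagonal fun ℓ => Complex.exp ((((cw ∘ ⇑(Equiv.swap i j)) ((lineOf (formSign L α w₀.1)).symm ℓ) : ℝ) : ℂ) * I) := fun cw => by
        rw [← coe_coe_gprimeBlockAt_empty L α w₀.1 cw, ← coe_coe_gprimeBlockAt_empty L α w₀.1 (cw ∘ ⇑(Equiv.swap i j)), ← hn cw, Subgroup.coe_mul, Subgroup.coe_mul,
          Units.val_mul, Units.val_mul]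
      -- `x ↦ update x w₀ (x w₀ ∘ (swap i j * f)) = update x' w₀ (x' w₀ ∘ f)` with `x' := update x w₀ (x w₀ ∘ swap i j)`
      have hx : Function.update x w₀ (x w₀ ∘ ⇑(Equiv.swap i j * f)) =
          Function.update (Function.update x w₀ (x w₀ ∘ ⇑(Equiv.swap i j))) w₀ ((Function.update x w₀ (x w₀ ∘ ⇑(Equiv.swap i j))) w₀ ∘ ⇑f) := by
        rw [Function.update_idem, Function.update_self, Equiv.Perm.coe_mul, Function.comp_assoc]
      rw [hx, ih]
      -- the swap step: substitute `g ↦ g · n̂`, `n̂ := update 1 w₀ n`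
      set nh : (∀ w : {w : {w : InfinitePlace L // IsComplex w} // p w}, ↥(archLocal L 3 (Matrix.diagonal α) w.1)) := Function.update 1 w₀ n with hnh
      have hint : ∀ g : (∀ w : {w : {w : InfinitePlace L // IsComplex w} // p w}, ↥(archLocal L 3 (Matrix.diagonal α) w.1)),
          Ψ (yp g, (Function.update x w₀ (x w₀ ∘ ⇑(Equiv.swap i j)), Z)) = Ψ (yp (g * nh), (x, Z)) := by
        intro g
        simp only [hΨ, hyp]
        congr 1
        congr 1
        refine Prod.ext (funext fun w => ?_) rfl
        dsimp only
        by_cases hw : w = w₀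
        · subst hw
          rw [Function.update_self, hnh, Pi.mul_apply, Function.update_self, _root_.mul_inv_rev, Subgroup.coe_mul, Subgroup.coe_mul, Units.val_mul, Units.val_mul,
            ← hnm (x w)]
          simp only [Matrix.mul_assoc]
        · rw [Function.update_of_ne hw, hnh, Pi.mul_apply, Function.update_of_ne hw, Pi.one_apply, mul_one]
      show (∫ g, Ψ (yp g, (Function.update x w₀ (x w₀ ∘ ⇑(Equiv.swap i j)), Z)) ∂(Measure.pi fun w : {w : {w : InfinitePlace L // IsComplex w} // p w} => ν'w w.1)) =
        ∫ g, Ψ (yp g, (x, Z)) ∂(Measure.pi fun w : {w : {w : InfinitePlace L // IsComplex w} // p w} => ν'w w.1)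
      simp_rw [hint]
      exact integral_mul_right_eq_self (μ := Measure.pi fun w : {w : {w : InfinitePlace L // IsComplex w} // p w} => ν'w w.1) (fun g => Ψ (yp g, (x, Z))) nh
  · -- (iii) periodicity
    intro w₀ n x Z
    show (∫ g, Ψ (yp g, (Function.update x w₀ (x w₀ + fun k => 2 * Real.pi * (n k : ℝ)), Z)) ∂(Measure.pi fun w : {w : {w : InfinitePlace L // IsComplex w} // p w} => ν'w w.1)) =
      ∫ g, Ψ (yp g, (x, Z)) ∂(Measure.pi fun w : {w : {w : InfinitePlace L // IsComplex w} // p w} => ν'w w.1)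
    refine integral_congr_ae (Filter.Eventually.of_forall fun g => ?_)
    simp only [hΨ]
    congr 1
    congr 1
    refine Prod.ext (funext fun w => ?_) rfl
    dsimp only
    by_cases hw : w = w₀
    · subst hw
      rw [Function.update_self, chartDiagonal_add_two_pi_mul]
    · rw [Function.update_of_ne hw]
  · -- (iv) the group-point reading
    intro x y
    show (∫ g, Ψ (yp g, (x, fun w' => ((M w' : GL (Fin 3) ℂ) : Matrix (Fin 3) (Fin 3) ℂ) * ((y w' : GL (Fin 3) ℂ) : Matrix (Fin 3) (Fin 3) ℂ) *
        (((M w')⁻¹ : GL (Fin 3) ℂ) : Matrix (Fin 3) (Fin 3) ℂ))) ∂(Measure.pi fun w : {w : {w : InfinitePlace L // IsComplex w} // p w} => ν'w w.1)) = _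
    refine integral_congr_ae (Filter.Eventually.of_forall fun g => ?_)
    simp only [hΨ, hyp]
    rw [hΘa, ← hasmk]
    congr 1
    congr 1
    refine Prod.ext (funext fun w => ?_) (funext fun w' => ?_)
    · -- the `p`-block: `↑g_w · diag · ↑g_w⁻¹ = ↑(g_w γ_w g_w⁻¹)` and the block of `e⁻¹(…)` at `w`
      rw [ContinuousMulEquiv.apply_symm_apply, MeasurableEquiv.piEquivPiSubtypeProd_symm_apply]
      simp only [dif_pos w.2, Subtype.coe_eta, Subgroup.coe_mul, Units.val_mul, coe_coe_gprimeBlockAt_empty]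
    · rw [ContinuousMulEquiv.apply_symm_apply, MeasurableEquiv.piEquivPiSubtypeProd_symm_apply]
      simp only [dif_neg w'.2]
      rw [← Matrix.mul_assoc, ← Matrix.mul_assoc, Units.inv_mul, Matrix.one_mul, Matrix.mul_assoc, Units.inv_mul, Matrix.mul_one]

end Average

/-! ## §4 The coupling factor -/

section Coupling

variable (L : Type) [Field L] [NumberField L] [IsCMField L] (α β : Fin 3 → L) (p : {w : InfinitePlace L // IsComplex w} → Prop) [DecidablePred p]
  [Fintype {w : {w : InfinitePlace L // IsComplex w} // p w}] [Fintype {w : {w : InfinitePlace L // IsComplex w} // ¬ p w}]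
  [∀ w : {w : InfinitePlace L // IsComplex w}, MeasurableSpace ↥(archLocal L 3 (Matrix.diagonal α) w)]
  [∀ w : {w : InfinitePlace L // IsComplex w}, BorelSpace ↥(archLocal L 3 (Matrix.diagonal α) w)]
  [∀ w : {w : InfinitePlace L // IsComplex w}, SecondCountableTopology ↥(archLocal L 3 (Matrix.diagonal α) w)]
  (ν'w : ∀ w : {w : InfinitePlace L // IsComplex w}, Measure ↥(archLocal L 3 (Matrix.diagonal α) w)) [∀ w, (ν'w w).IsHaarMeasure] [∀ w, (ν'w w).IsMulRightInvariant]

/-- **THE COUPLING FACTOR OF THE PER-BALL TEST FUNCTION (E3a, slice hIT).**  Data: house frame `α` (`α_i ≠ 0`, real at every place), the block `p` of `α`-DEFINITE places, place isomorphisms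
`ι_{w′} : U(α)_{w′} ≃ U(β)_{w′}` on the `¬p`-block realised by fixed matrices `M_{w′}` (★ (IT)-1 `exists_continuousMulEquiv_archLocal_innerTwist`), a test function `a′ ∈ C_c^∞(G′_∞(α))`, a centre
`b ∈ K^p` of one-place elliptic classes.  Then there are `ε > 0` and a coupling `G : (Π_p ℂ³) → (Π_{¬p} U(β)_{w′}) → ℂ` (hβ's currency) such that
(a) **§2(7) CERTIFICATE**: `G z y = Gamb (z, ↑y)` for a `C^∞` ambient `Gamb` on `(Π_p ℂ³) × (Π_{¬p} M₃(ℂ))` vanishing off a compact of the ambient `I`-block — docks on ★ p852249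
`archSmooth_prod_classMul_tensor_mul_coupling_of_forall_eq_zero` (`I := {w // ¬ p w}`, `v := Subtype.val`);
(b) **THE (T1) HYPOTHESIS `hG` ON THE `ε`-BALL** (= (G1) ★ p852328's `hCoup` letter, token for token): for angles `x` whose classes are `ε`-close to `b` and every `α`-side block `y`,
`G (cl x) (ι_I y) = ∫_{Π_p U(α)_w} a′ (e_α⁻¹ ((g_v γ^α_v(∅, x_v) g_v⁻¹)_p, y)) d⊗_p ν′_v` (the `U(3)^D`-average; label `∅` — immaterial at the definite places, §2).
CONSTRUCTION: `Ā` = §3 `exists_ambientAverage`; ★ (B3) `exists_contDiff_comp_classFun_near_of_mem_range` ⇒ `ε`, `Ã` with `Ā(x, Z) = Ã(cl x, Z)` on the ball; `χ` = Mathlib `ContDiffBump`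
(through `toEuclidean`) equal to `1` on the compact `ι_I(pr_I(e_α(tsupport a′)))` ⊆ `M₃(ℂ)^I`; `Gamb := χ · Ã`.  On the ball and at `Z = ↑(ι_I y)`: `Ã = Ā =` the group average (§3 (iv)), and either
the average vanishes (both sides `0`) or some `e_α⁻¹(…, y)` lies in `tsupport a′`, whence `χ = 1`. [cite: Rogawski1990, §8.2 p. 122; §14.2 (14.2.1) p. 232] [cite: Shelstad1979, §4 p. 24]
[cite: Bouaziz1994IntegralesOrbitales, §6.2 p. 591] [cite: Glaeser1963Newton, Thm. II] -/
theorem exists_coupling (hα : ∀ i, α i ≠ 0) (hreal : ∀ (w : {w : InfinitePlace L // IsComplex w}) (i : Fin 3), (w.1.embedding (α i)).im = 0) (hp : ∀ w, p w → w ∉ splitChartPlaces L α)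
    (ι : ∀ w' : {w : {w : InfinitePlace L // IsComplex w} // ¬ p w}, ↥(archLocal L 3 (Matrix.diagonal α) w'.1) ≃ₜ* ↥(archLocal L 3 (Matrix.diagonal β) w'.1))
    (M : {w : {w : InfinitePlace L // IsComplex w} // ¬ p w} → GL (Fin 3) ℂ)
    (hM : ∀ (w' : {w : {w : InfinitePlace L // IsComplex w} // ¬ p w}) (h : ↥(archLocal L 3 (Matrix.diagonal α) w'.1)), ((ι w' h : ↥(archLocal L 3 (Matrix.diagonal β) w'.1)) : GL (Fin 3) ℂ) = M w' * (h : GL (Fin 3) ℂ) * (M w')⁻¹)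
    (a' : ↥(arch (↥(maximalRealSubfield L)) L (IsCMField.complexConj L) 3 (Matrix.diagonal α)) → ℂ) (ha' : ArchSmooth L 3 (Matrix.diagonal α) a')
    (b : {w : {w : InfinitePlace L // IsComplex w} // p w} → ℂ × ℂ × ℂ) (hb : ∀ v, b v ∈ Set.range fun t : Fin 3 → ℝ => esymm3 fun i => Complex.exp ((t i : ℂ) * I)) :
    ∃ ε : ℝ, 0 < ε ∧ ∃ G : ({w : {w : InfinitePlace L // IsComplex w} // p w} → ℂ × ℂ × ℂ) → (∀ w' : {w : {w : InfinitePlace L // IsComplex w} // ¬ p w}, ↥(archLocal L 3 (Matrix.diagonal β) w'.1)) → ℂ,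
      (∃ Gamb : ({w : {w : InfinitePlace L // IsComplex w} // p w} → ℂ × ℂ × ℂ) × ({w : {w : InfinitePlace L // IsComplex w} // ¬ p w} → Matrix (Fin 3) (Fin 3) ℂ) → ℂ,
          ContDiff ℝ ∞ Gamb ∧ (∃ KI : Set ({w : {w : InfinitePlace L // IsComplex w} // ¬ p w} → Matrix (Fin 3) (Fin 3) ℂ), IsCompact KI ∧ ∀ z, ∀ Z ∉ KI, Gamb (z, Z) = 0) ∧
          ∀ z yβ, G z yβ = Gamb (z, fun w' => ((yβ w' : GL (Fin 3) ℂ) : Matrix (Fin 3) (Fin 3) ℂ))) ∧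
      ∀ x : {w : {w : InfinitePlace L // IsComplex w} // p w} → Fin 3 → ℝ, (∀ v, dist (esymm3 fun i => Complex.exp ((x v i : ℂ) * I)) (b v) < ε) →
        ∀ y : (∀ w' : {w : {w : InfinitePlace L // IsComplex w} // ¬ p w}, ↥(archLocal L 3 (Matrix.diagonal α) w'.1)),
          G (fun v => esymm3 fun i => Complex.exp ((x v i : ℂ) * I)) (fun w' => ι w' (y w')) =
            ∫ g : (∀ v : {w : {w : InfinitePlace L // IsComplex w} // p w}, ↥(archLocal L 3 (Matrix.diagonal α) (v : {w : InfinitePlace L // IsComplex w}))),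
              a' ((archPiEquivCM 3 L (Matrix.diagonal α)).symm
                ((MeasurableEquiv.piEquivPiSubtypeProd (fun w : {w : InfinitePlace L // IsComplex w} => ↥(archLocal L 3 (Matrix.diagonal α) w)) p).symm
                  (fun v => g v * gprimeBlockAt L α v.1 ∅ (x v) * (g v)⁻¹, y)))
              ∂(Measure.pi fun v : {w : {w : InfinitePlace L // IsComplex w} // p w} => ν'w v) := by
  -- the ambient average and its local class germ (B3)
  obtain ⟨A, hA, hAs, hAp, hAg⟩ := exists_ambientAverage L α p ν'w hα hreal hp a' ha' M
  have htuple : ∀ t : Fin 3 → ℝ, (esymm3 fun i => Complex.exp ((t i : ℂ) * I)) =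
      ((Complex.exp ((((t 0 : ℝ)) : ℂ) * I) + Complex.exp ((((t 1 : ℝ)) : ℂ) * I) + Complex.exp ((((t 2 : ℝ)) : ℂ) * I),
        Complex.exp ((((t 0 : ℝ)) : ℂ) * I) * Complex.exp ((((t 1 : ℝ)) : ℂ) * I) + Complex.exp ((((t 0 : ℝ)) : ℂ) * I) * Complex.exp ((((t 2 : ℝ)) : ℂ) * I) +
          Complex.exp ((((t 1 : ℝ)) : ℂ) * I) * Complex.exp ((((t 2 : ℝ)) : ℂ) * I),
        Complex.exp ((((t 0 : ℝ)) : ℂ) * I) * Complex.exp ((((t 1 : ℝ)) : ℂ) * I) * Complex.exp ((((t 2 : ℝ)) : ℂ) * I)) : ℂ × ℂ × ℂ) := fun t => rfl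
  have hb' : ∀ v, b v ∈ Set.range fun t : Fin 3 → ℝ => ((Complex.exp ((((t 0 : ℝ)) : ℂ) * I) + Complex.exp ((((t 1 : ℝ)) : ℂ) * I) + Complex.exp ((((t 2 : ℝ)) : ℂ) * I),
        Complex.exp ((((t 0 : ℝ)) : ℂ) * I) * Complex.exp ((((t 1 : ℝ)) : ℂ) * I) + Complex.exp ((((t 0 : ℝ)) : ℂ) * I) * Complex.exp ((((t 2 : ℝ)) : ℂ) * I) +
          Complex.exp ((((t 1 : ℝ)) : ℂ) * I) * Complex.exp ((((t 2 : ℝ)) : ℂ) * I),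
        Complex.exp ((((t 0 : ℝ)) : ℂ) * I) * Complex.exp ((((t 1 : ℝ)) : ℂ) * I) * Complex.exp ((((t 2 : ℝ)) : ℂ) * I)) : ℂ × ℂ × ℂ) := fun v => by
    obtain ⟨t, ht⟩ := hb v
    exact ⟨t, ht⟩
  obtain ⟨ε, hε, F, hF, hagree⟩ := exists_contDiff_comp_classFun_near_of_mem_range (D := {w : {w : InfinitePlace L // IsComplex w} // p w})
    (P := {w : {w : InfinitePlace L // IsComplex w} // ¬ p w} → Matrix (Fin 3) (Fin 3) ℂ) (E := ℂ) A hA hAs hAp b hb'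
  -- the compact image of the support on the ambient `I`-block, and the cut-off
  set Kamb : Set ({w : {w : InfinitePlace L // IsComplex w} // ¬ p w} → Matrix (Fin 3) (Fin 3) ℂ) :=
    (fun k : ↥(arch (↥(maximalRealSubfield L)) L (IsCMField.complexConj L) 3 (Matrix.diagonal α)) => fun w' : {w : {w : InfinitePlace L // IsComplex w} // ¬ p w} =>
      ((ι w' (archPiEquivCM 3 L (Matrix.diagonal α) k w'.1) : GL (Fin 3) ℂ) : Matrix (Fin 3) (Fin 3) ℂ)) '' tsupport a' with hKamb
  have hKc : IsCompact Kamb := by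
    refine ha'.hasCompactSupport.isCompact.image (continuous_pi fun w' => ?_)
    exact Units.continuous_val.comp (continuous_subtype_val.comp ((ι w').continuous.comp ((continuous_apply w'.1).comp (archPiEquivCM 3 L (Matrix.diagonal α)).continuous)))
  set eP := (toEuclidean : ({w : {w : InfinitePlace L // IsComplex w} // ¬ p w} → Matrix (Fin 3) (Fin 3) ℂ) ≃L[ℝ] EuclideanSpace ℝ (Fin (Module.finrank ℝ ({w : {w : InfinitePlace L // IsComplex w} // ¬ p w} → Matrix (Fin 3) (Fin 3) ℂ)))) with heP
  obtain ⟨R, hR⟩ : ∃ R : ℝ, eP '' Kamb ⊆ Metric.closedBall (eP 0) R := (Metric.isBounded_iff_subset_closedBall (eP 0)).1 (hKc.image eP.continuous).isBounded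
  let bump : ContDiffBump (eP 0) := ⟨max R 0 + 1, max R 0 + 2, by positivity, by linarith⟩
  set χ : ({w : {w : InfinitePlace L // IsComplex w} // ¬ p w} → Matrix (Fin 3) (Fin 3) ℂ) → ℝ := fun Z => bump (eP Z) with hχ
  have hχd : ContDiff ℝ ∞ χ := bump.contDiff.comp eP.contDiff
  have hχc : HasCompactSupport χ := bump.hasCompactSupport.comp_homeomorph eP.toHomeomorph
  have hχ1 : ∀ Z ∈ Kamb, χ Z = 1 := fun Z hZ => by
    refine bump.one_of_mem_closedBall (Metric.mem_closedBall.2 ?_)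
    have h := Metric.mem_closedBall.1 (hR ⟨Z, hZ, rfl⟩)
    show dist (eP Z) (eP 0) ≤ max R 0 + 1
    linarith [le_max_left R 0]
  -- the coupling
  refine ⟨ε, hε, fun z yβ => ((χ (fun w' => ((yβ w' : GL (Fin 3) ℂ) : Matrix (Fin 3) (Fin 3) ℂ)) : ℝ) : ℂ) * F (z, fun w' => ((yβ w' : GL (Fin 3) ℂ) : Matrix (Fin 3) (Fin 3) ℂ)),
    ⟨fun q => ((χ q.2 : ℝ) : ℂ) * F q, (Complex.ofRealCLM.contDiff.comp (hχd.comp contDiff_snd)).mul hF,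
      ⟨tsupport χ, hχc.isCompact, fun z Z hZ => by
        show ((χ Z : ℝ) : ℂ) * F (z, Z) = 0
        rw [image_eq_zero_of_notMem_tsupport hZ, Complex.ofReal_zero, zero_mul]⟩, fun z yβ => rfl⟩, ?_⟩
  intro x hx y
  -- the `β`-side block of `ι_I y` in matrices
  have hZ : (fun w' : {w : {w : InfinitePlace L // IsComplex w} // ¬ p w} => (((ι w' (y w') : ↥(archLocal L 3 (Matrix.diagonal β) w'.1)) : GL (Fin 3) ℂ) : Matrix (Fin 3) (Fin 3) ℂ)) =
      fun w' => ((M w' : GL (Fin 3) ℂ) : Matrix (Fin 3) (Fin 3) ℂ) * ((y w' : GL (Fin 3) ℂ) : Matrix (Fin 3) (Fin 3) ℂ) * (((M w')⁻¹ : GL (Fin 3) ℂ) : Matrix (Fin 3) (Fin 3) ℂ) := by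
    funext w'; rw [hM, Units.val_mul, Units.val_mul]
  -- Glaeser agreement on the ball, then the group-point reading
  have hagx := hagree x (fun w' : {w : {w : InfinitePlace L // IsComplex w} // ¬ p w} => (((ι w' (y w') : ↥(archLocal L 3 (Matrix.diagonal β) w'.1)) : GL (Fin 3) ℂ) : Matrix (Fin 3) (Fin 3) ℂ))
    (fun w => by rw [← htuple]; exact hx w)
  show ((χ (fun w' => ((ι w' (y w') : GL (Fin 3) ℂ) : Matrix (Fin 3) (Fin 3) ℂ)) : ℝ) : ℂ) * F ((fun v => esymm3 fun i => Complex.exp ((x v i : ℂ) * I)), _) = _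
  rw [show (fun v : {w : {w : InfinitePlace L // IsComplex w} // p w} => esymm3 fun i => Complex.exp ((x v i : ℂ) * I)) = fun v => ((Complex.exp ((((x v 0 : ℝ)) : ℂ) * I) + Complex.exp ((((x v 1 : ℝ)) : ℂ) * I) + Complex.exp ((((x v 2 : ℝ)) : ℂ) * I),
        Complex.exp ((((x v 0 : ℝ)) : ℂ) * I) * Complex.exp ((((x v 1 : ℝ)) : ℂ) * I) + Complex.exp ((((x v 0 : ℝ)) : ℂ) * I) * Complex.exp ((((x v 2 : ℝ)) : ℂ) * I) +
          Complex.exp ((((x v 1 : ℝ)) : ℂ) * I) * Complex.exp ((((x v 2 : ℝ)) : ℂ) * I),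
        Complex.exp ((((x v 0 : ℝ)) : ℂ) * I) * Complex.exp ((((x v 1 : ℝ)) : ℂ) * I) * Complex.exp ((((x v 2 : ℝ)) : ℂ) * I)) : ℂ × ℂ × ℂ) from funext fun v => htuple (x v),
    ← hagx, hZ, hAg x y]
  -- either the average vanishes, or `χ = 1` there
  by_cases h0 : (∫ g : (∀ w : {w : {w : InfinitePlace L // IsComplex w} // p w}, ↥(archLocal L 3 (Matrix.diagonal α) w.1)),
      a' ((archPiEquivCM 3 L (Matrix.diagonal α)).symm
        ((MeasurableEquiv.piEquivPiSubtypeProd (fun w : {w : InfinitePlace L // IsComplex w} => ↥(archLocal L 3 (Matrix.diagonal α) w)) p).symm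
          (fun w => g w * gprimeBlockAt L α w.1 ∅ (x w) * (g w)⁻¹, y)))
      ∂(Measure.pi fun w : {w : {w : InfinitePlace L // IsComplex w} // p w} => ν'w w.1)) = 0
  · rw [h0, mul_zero]
  · -- some integrand is non-zero, so `y` is the `I`-block of a point of `tsupport a′`
    obtain ⟨g, hg⟩ : ∃ g : (∀ w : {w : {w : InfinitePlace L // IsComplex w} // p w}, ↥(archLocal L 3 (Matrix.diagonal α) w.1)),
        a' ((archPiEquivCM 3 L (Matrix.diagonal α)).symm
          ((MeasurableEquiv.piEquivPiSubtypeProd (fun w : {w : InfinitePlace L // IsComplex w} => ↥(archLocal L 3 (Matrix.diagonal α) w)) p).symm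
            (fun w => g w * gprimeBlockAt L α w.1 ∅ (x w) * (g w)⁻¹, y))) ≠ 0 := by
      by_contra hall
      simp only [ne_eq, not_exists, not_not] at hall
      exact h0 (by simp_rw [hall, integral_zero])
    have hmem : (fun w' : {w : {w : InfinitePlace L // IsComplex w} // ¬ p w} => (((ι w' (y w') : ↥(archLocal L 3 (Matrix.diagonal β) w'.1)) : GL (Fin 3) ℂ) : Matrix (Fin 3) (Fin 3) ℂ)) ∈ Kamb := by
      refine ⟨_, subset_tsupport _ (Function.mem_support.2 hg), funext fun w' => ?_⟩
      dsimp only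
      rw [ContinuousMulEquiv.apply_symm_apply, MeasurableEquiv.piEquivPiSubtypeProd_symm_apply]
      simp only [dif_neg w'.2]
    rw [hZ] at hmem
    rw [hχ1 _ hmem, Complex.ofReal_one, one_mul]

end Coupling

/-! ## §5 The `hIT` reading from the coupling (two-frame statement; ★ (T1) ∘ §4 (b)) -/

section HIT

variable (L : Type) [Field L] [NumberField L] [IsCMField L] (α β : Fin 3 → L) (S : Finset {w : InfinitePlace L // IsComplex w})
  -- TWO-FRAME HYGIENE as in ★ (T1): the `β`-frame measure facts are an `And`-package, NOT instance families
  [∀ w : {w : InfinitePlace L // IsComplex w}, MeasurableSpace ↥(archLocal L 3 (Matrix.diagonal β) w)]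
  [∀ w : {w : InfinitePlace L // IsComplex w}, BorelSpace ↥(archLocal L 3 (Matrix.diagonal β) w)]
  [∀ w : {w : InfinitePlace L // IsComplex w}, LocallyCompactSpace ↥(archLocal L 3 (Matrix.diagonal β) w)]
  [∀ w : {w : InfinitePlace L // IsComplex w}, SecondCountableTopology ↥(archLocal L 3 (Matrix.diagonal β) w)]
  [∀ w : {w : InfinitePlace L // IsComplex w}, MeasurableSpace (↥(archLocal L 3 (Matrix.diagonal β) w) ⧸ chartTorusGLoc L β w S)]
  [∀ w : {w : InfinitePlace L // IsComplex w}, BorelSpace (↥(archLocal L 3 (Matrix.diagonal β) w) ⧸ chartTorusGLoc L β w S)]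
  (νβw : ∀ w : {w : InfinitePlace L // IsComplex w}, Measure ↥(archLocal L 3 (Matrix.diagonal β) w))
  (t' : ∀ w : {w : InfinitePlace L // IsComplex w}, Measure ↥(chartTorusGLoc L β w S))
  (p : {w : InfinitePlace L // IsComplex w} → Prop) [DecidablePred p]
  [Fintype {w : {w : InfinitePlace L // IsComplex w} // p w}] [Fintype {w : {w : InfinitePlace L // IsComplex w} // ¬ p w}]
  (hβm : ∀ w' : {w : {w : InfinitePlace L // IsComplex w} // ¬ p w}, (t' w'.1).IsHaarMeasure ∧ (t' w'.1).IsInvInvariant ∧ (νβw w'.1).IsHaarMeasure ∧ (νβw w'.1).IsMulRightInvariant)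
  [∀ w : {w : InfinitePlace L // IsComplex w}, MeasurableSpace ↥(archLocal L 3 (Matrix.diagonal α) w)]
  [∀ w : {w : InfinitePlace L // IsComplex w}, BorelSpace ↥(archLocal L 3 (Matrix.diagonal α) w)]
  [∀ w : {w : InfinitePlace L // IsComplex w}, LocallyCompactSpace ↥(archLocal L 3 (Matrix.diagonal α) w)]
  [∀ w : {w : InfinitePlace L // IsComplex w}, SecondCountableTopology ↥(archLocal L 3 (Matrix.diagonal α) w)]
  [∀ w : {w : InfinitePlace L // IsComplex w}, MeasurableSpace (↥(archLocal L 3 (Matrix.diagonal α) w) ⧸ chartTorusGLoc L α w S)]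
  [∀ w : {w : InfinitePlace L // IsComplex w}, BorelSpace (↥(archLocal L 3 (Matrix.diagonal α) w) ⧸ chartTorusGLoc L α w S)]
  (ν'w : ∀ w : {w : InfinitePlace L // IsComplex w}, Measure ↥(archLocal L 3 (Matrix.diagonal α) w)) [∀ w, (ν'w w).IsHaarMeasure] [∀ w, (ν'w w).IsMulRightInvariant]
  (t : ∀ w : {w : InfinitePlace L // IsComplex w}, Measure ↥(chartTorusGLoc L α w S)) [∀ w, (t w).IsHaarMeasure] [∀ w, (t w).IsInvInvariant]
  (ι : ∀ w' : {w : {w : InfinitePlace L // IsComplex w} // ¬ p w}, ↥(archLocal L 3 (Matrix.diagonal α) w'.1) ≃ₜ* ↥(archLocal L 3 (Matrix.diagonal β) w'.1))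
  (hι : ∀ (w' : {w : {w : InfinitePlace L // IsComplex w} // ¬ p w}) (S' : Finset {w : InfinitePlace L // IsComplex w}) (cw : Fin 3 → ℝ), ι w' (gprimeBlockAt L α w'.1 S' cw) = gprimeBlockAt L β w'.1 S' cw)
  (ht' : ∀ w' : {w : {w : InfinitePlace L // IsComplex w} // ¬ p w}, t' w'.1 = (t w'.1).map
    (ContinuousMulEquiv.restrictSubgroup (ι w') (chartTorusGLoc L α w'.1 S) (chartTorusGLoc L β w'.1 S) (fun g => (innerTwist_mem_chartTorusGLoc_iff L α β w'.1 (ι w') (hι w') S g).symm)))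
  (hνβ : ∀ w' : {w : {w : InfinitePlace L // IsComplex w} // ¬ p w}, νβw w'.1 = (ν'w w'.1).map (ι w'))

include hνβ ht' hβm in
/-- **THE `hIT` READING FROM THE COUPLING**: with the coupling property (b) of `exists_coupling` (hypothesis `hGb`, radius `ε`, centre `b`), a `D`-block point `c_D` whose classes
`z_v = esymm3 (e^{i c_D v})` (`hz` — for the chart point of ★ hβ: `bzClassMapG S c v.1`, ★ `bzClassMapG_apply_of_not_mem`; the `p`-places avoid `S`) are `ε`-close to `b` (`hzb` — the
class multipliers are ALIVE), and `¬p`-block coordinates `cIβ = cIα`: the `β`-side `¬p`-block reading of `G z` equals the `α`-side `¬p`-block reading of the `U(3)^D`-average — ★ CORE's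
`hIT` body `Rβ ρ₂ = Rα ρ₂`, by ★ (T1) `blockReading_coupling_eq_average`. [cite: Rogawski1990, §8.2 p. 122; §14.2 (14.2.1) p. 232] [cite: Shelstad1979, §4 p. 24] [cite: Bouaziz1994IntegralesOrbitales, §6.2 p. 591] -/
theorem blockReading_eq_of_coupling_near (hp : ∀ w, p w → w ∉ splitChartPlaces L α) (ε : ℝ) (b : {w : {w : InfinitePlace L // IsComplex w} // p w} → ℂ × ℂ × ℂ)
    (a' : ↥(arch (↥(maximalRealSubfield L)) L (IsCMField.complexConj L) 3 (Matrix.diagonal α)) → ℂ)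
    (G : ({w : {w : InfinitePlace L // IsComplex w} // p w} → ℂ × ℂ × ℂ) → (∀ w' : {w : {w : InfinitePlace L // IsComplex w} // ¬ p w}, ↥(archLocal L 3 (Matrix.diagonal β) w'.1)) → ℂ)
    (hGb : ∀ x : {w : {w : InfinitePlace L // IsComplex w} // p w} → Fin 3 → ℝ, (∀ v, dist (esymm3 fun i => Complex.exp ((x v i : ℂ) * I)) (b v) < ε) →
        ∀ y : (∀ w' : {w : {w : InfinitePlace L // IsComplex w} // ¬ p w}, ↥(archLocal L 3 (Matrix.diagonal α) w'.1)),
          G (fun v => esymm3 fun i => Complex.exp ((x v i : ℂ) * I)) (fun w' => ι w' (y w')) =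
            ∫ g : (∀ v : {w : {w : InfinitePlace L // IsComplex w} // p w}, ↥(archLocal L 3 (Matrix.diagonal α) (v : {w : InfinitePlace L // IsComplex w}))),
              a' ((archPiEquivCM 3 L (Matrix.diagonal α)).symm
                ((MeasurableEquiv.piEquivPiSubtypeProd (fun w : {w : InfinitePlace L // IsComplex w} => ↥(archLocal L 3 (Matrix.diagonal α) w)) p).symm
                  (fun v => g v * gprimeBlockAt L α v.1 ∅ (x v) * (g v)⁻¹, y)))
              ∂(Measure.pi fun v : {w : {w : InfinitePlace L // IsComplex w} // p w} => ν'w v))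
    (cD : {w : {w : InfinitePlace L // IsComplex w} // p w} → Fin 3 → ℝ) (z : {w : {w : InfinitePlace L // IsComplex w} // p w} → ℂ × ℂ × ℂ) (hz : ∀ v, z v = esymm3 fun i => Complex.exp ((cD v i : ℂ) * I))
    (hzb : ∀ v, dist (z v) (b v) < ε)
    (cIβ cIα : {w : {w : InfinitePlace L // IsComplex w} // ¬ p w} → Fin 3 → ℝ) (hcI : cIβ = cIα) :
    (∏ w' : {w : {w : InfinitePlace L // IsComplex w} // ¬ p w}, ((t' w'.1 (chartBoxImgGLoc L β w'.1 S)).toReal : ℂ)) *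
        ∫ b' : (∀ w' : {w : {w : InfinitePlace L // IsComplex w} // ¬ p w}, ↥(archLocal L 3 (Matrix.diagonal β) w'.1) ⧸ chartTorusGLoc L β w'.1 S),
          G z (fun w' => descConj (gprimeBlockAt L β w'.1 S (cIβ w')) (chartTorusGLoc L β w'.1 S) (forall_mem_chartTorusGLoc_comm L β w'.1 S (cIβ w')) id (b' w'))
          ∂(Measure.pi fun w' : {w : {w : InfinitePlace L // IsComplex w} // ¬ p w} =>
              haveI := (hβm w').1; haveI := (hβm w').2.1; haveI := (hβm w').2.2.1; haveI := (hβm w').2.2.2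
              quotientMeasure (chartTorusGLoc L β w'.1 S) (t' w'.1) (isClosed_chartTorusGLoc L β w'.1 S) (νβw w'.1)) =
      (∏ w' : {w : {w : InfinitePlace L // IsComplex w} // ¬ p w}, ((t w'.1 (chartBoxImgGLoc L α w'.1 S)).toReal : ℂ)) *
        ∫ b : (∀ w' : {w : {w : InfinitePlace L // IsComplex w} // ¬ p w}, ↥(archLocal L 3 (Matrix.diagonal α) w'.1) ⧸ chartTorusGLoc L α w'.1 S),
          (∫ g : (∀ w : {w : {w : InfinitePlace L // IsComplex w} // p w}, ↥(archLocal L 3 (Matrix.diagonal α) w.1)),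
            a' ((archPiEquivCM 3 L (Matrix.diagonal α)).symm
              ((MeasurableEquiv.piEquivPiSubtypeProd (fun w : {w : InfinitePlace L // IsComplex w} => ↥(archLocal L 3 (Matrix.diagonal α) w)) p).symm
                (fun w => g w * gprimeBlockAt L α w.1 S (cD w) * (g w)⁻¹,
                  fun w' => descConj (gprimeBlockAt L α w'.1 S (cIα w')) (chartTorusGLoc L α w'.1 S)
                    (forall_mem_chartTorusGLoc_comm L α w'.1 S (cIα w')) id (b w'))))
            ∂(Measure.pi fun w : {w : {w : InfinitePlace L // IsComplex w} // p w} => ν'w w.1))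
          ∂(Measure.pi fun w' : {w : {w : InfinitePlace L // IsComplex w} // ¬ p w} =>
              quotientMeasure (chartTorusGLoc L α w'.1 S) (t w'.1) (isClosed_chartTorusGLoc L α w'.1 S) (ν'w w'.1)) := by
  have hzf : z = fun v => esymm3 fun i => Complex.exp ((cD v i : ℂ) * I) := funext hz
  subst hzf
  -- label independence at the definite places
  have hS : ∀ w : {w : {w : InfinitePlace L // IsComplex w} // p w}, gprimeBlockAt L α w.1 S (cD w) = gprimeBlockAt L α w.1 ∅ (cD w) :=
    fun w => gprimeBlockAt_eq_empty_of_not_mem_splitChartPlaces L α (hp w.1 w.2) S (cD w)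
  refine blockReading_coupling_eq_average L α β S νβw t' p hβm ν'w t ι hι ht' hνβ cD cIβ cIα hcI a' G _ fun y => ?_
  simp only [hS]
  exact hGb cD hzb y

end HIT

end Literature.NumberTheory.Rogawski1990
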